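import Mathlib
import HarnessLib
import Summits.ValiantsHypothesis.ValiantsHypothesis.Theses.MonotoneRestoration
import Literature.ModelTheory.FiniteModelTheory.CkEquiv
import Summits.ValiantsHypothesis.ValiantsHypothesis.Theorems.MonotoneRestorationMonotoneRestorationQPCruxImpliesFooling
import Summits.ValiantsHypothesis.ValiantsHypothesis.Theorems.MonotoneRestorationMonotoneRestorationQPFoolingOfQPSymmetric

/-!
# `MonotoneRestorationQP` implies FOOLING at polylog level (crux `stmt-ValiantsHypothesis-15886`)

Helper file (`--supports stmt-ValiantsHypothesis-15886`) of line `Sketch`, lead c2 — assembly of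
the wave-2 stubs F1 (`stub_fooling_of_qpSymmetric`: quasi-polynomial square-symmetric circuits
take equal values at `C^{(log₂ n + c')^{c'}}`-equivalent graphs, Dawar–Wilsenach Thm 5.1 + the
support theorem at orbit size `≤ C(n, polylog)` + Anderson–Dawar) and F2
(`stub_crux_implies_fooling`: the diagonal argument passing from families to single polynomials).

* `monotoneRestorationQP_implies_fooling` — the crux implies the strategist's typed statement
  `Fooling` (STRATEGY-CENSUS.md §D2/§N1, `Cruxes/…/StrategyCensus.lean`, inlined here): for
  every monotone exponent `c` there is `c'` such that every matrix-symmetric `f ∈ ℝ≥0[x_ij]` on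
  the `n × n` matrix with `deg f ≤ (n+2)^c` and monotone complexity `≤ (n+2)^c` takes equal
  (complexified) values at the adjacency matrices of any two `C^{(log₂ n + c')^{c'}}`-equivalent
  graphs on `Fin n`.
* `not_monotoneRestorationQP_of_separating` — the REFUTATION INSTRUMENT AT POLYLOG SCALE
  (contrapositive): one monotone exponent `c` for which, at every level `c'`, some
  matrix-symmetric monotone-easy `f` separates two `C^{(log₂ n + c')^{c'}}`-equivalent graphs,
  refutes the crux.  This sharpens the line's S4 (`stub_symmetricLB_of_linearCountingWidth`,
  which needs separated pairs on `O(k)` vertices, i.e. LINEAR counting width): super-polylog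
  counting width of a monotone-easy invariant family now suffices.
-/

-- `ValiantsHypothesis.ValiantsHypothesis`: the D-0017 layout repeats the problem name in the path.
set_option linter.dupNamespace false

namespace Summit.ValiantsHypothesis.ValiantsHypothesis.Theorems

open Summit.ValiantsHypothesis.ValiantsHypothesis.Theses.MonotoneRestoration
open Literature.Computability.AlgebraicComplexity
open Literature.ModelTheory.FiniteModelTheory

/-- **The crux implies FOOLING at polylog level.** If `MonotoneRestorationQP` holds then for
every `c` there is `c'` such that every matrix-symmetric nonnegative polynomial on the `n × n`
matrix of total degree `≤ (n+2)^c` and monotone complexity `≤ (n+2)^c` takes equal complexified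
values at the `0/1` adjacency matrices of any two `C^{(log₂ n + c')^{c'}}`-equivalent graphs on
`Fin n` (F2 `stub_crux_implies_fooling` fed with F1 `stub_fooling_of_qpSymmetric`).
[cite: DawarWilsenach2025, §6 p. 17] -/
theorem monotoneRestorationQP_implies_fooling :
    MonotoneRestorationQP →
    ∀ c : ℕ, ∃ c' : ℕ, ∀ (n : ℕ) (f : MvPolynomial (Fin n × Fin n) NNReal),
      (∀ σ τ : Equiv.Perm (Fin n),
        MvPolynomial.rename (fun p : Fin n × Fin n => (σ p.1, τ p.2)) f = f) →
      f.totalDegree ≤ (n + 2) ^ c → complexity (k := NNReal) f ≤ (n + 2) ^ c →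
      ∀ X Y : SimpleGraph (Fin n), CkEquiv ((Nat.log 2 n + c') ^ c') X Y →
        MvPolynomial.eval (Set.indicator {ij : Fin n × Fin n | X.Adj ij.1 ij.2} 1)
            (MvPolynomial.map (Complex.ofRealHom.comp NNReal.toRealHom) f) =
          MvPolynomial.eval (Set.indicator {ij : Fin n × Fin n | Y.Adj ij.1 ij.2} 1)
            (MvPolynomial.map (Complex.ofRealHom.comp NNReal.toRealHom) f) :=
  stub_crux_implies_fooling stub_fooling_of_qpSymmetric

/-- **Refutation instrument at polylog scale.** If for some monotone exponent `c` and EVERY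
level `c'` there is a matrix-symmetric `f ∈ ℝ≥0[x_ij]` on some `n × n` matrix with
`deg f ≤ (n+2)^c`, monotone complexity `≤ (n+2)^c`, and two `C^{(log₂ n + c')^{c'}}`-equivalent
graphs on `Fin n` at whose adjacency matrices the complexified values of `f` differ, then the
crux `MonotoneRestorationQP` is false. [folklore] -/
theorem not_monotoneRestorationQP_of_separating
    (h : ∃ c : ℕ, ∀ c' : ℕ, ∃ (n : ℕ) (f : MvPolynomial (Fin n × Fin n) NNReal),
      (∀ σ τ : Equiv.Perm (Fin n),
        MvPolynomial.rename (fun p : Fin n × Fin n => (σ p.1, τ p.2)) f = f) ∧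
      f.totalDegree ≤ (n + 2) ^ c ∧ complexity (k := NNReal) f ≤ (n + 2) ^ c ∧
      ∃ X Y : SimpleGraph (Fin n), CkEquiv ((Nat.log 2 n + c') ^ c') X Y ∧
        MvPolynomial.eval (Set.indicator {ij : Fin n × Fin n | X.Adj ij.1 ij.2} 1)
            (MvPolynomial.map (Complex.ofRealHom.comp NNReal.toRealHom) f) ≠
          MvPolynomial.eval (Set.indicator {ij : Fin n × Fin n | Y.Adj ij.1 ij.2} 1)
            (MvPolynomial.map (Complex.ofRealHom.comp NNReal.toRealHom) f)) :
    ¬ MonotoneRestorationQP := by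
  intro hcrux
  obtain ⟨c, hc⟩ := h
  obtain ⟨c', hc'⟩ := monotoneRestorationQP_implies_fooling hcrux c
  obtain ⟨n, f, hsym, hdeg, hcx, X, Y, hXY, hne⟩ := hc c'
  exact hne (hc' n f hsym hdeg hcx X Y hXY)

end Summit.ValiantsHypothesis.ValiantsHypothesis.Theorems
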